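import Summits.Ventures.PercRepro.S1CFCapsLineTwo
import Summits.Ventures.PercRepro.S1CFGFour

/-!
# PercRepro — `Q₄²` ON ANY `n ≥ 9` POINTS: THE SPLIT `Q₄² ≤ 5 + (n − 3) · Q₃¹ + D₂² + 6 · D₂` (p1, gen 38)

The `12`-point theorems of S1CFCapsLine / S1CFCapsLineTwo (p1, gen 37) for every ground set of `n ≥ 9` points. For a
loopless coloop-free matroid of nullity `4`, a `4`-set `X` of rank `≤ 2` either contains a dependent pair `P = {p, p'}` —
then `X = P ∪ Y` with `{p} ∪ Y` dependent: `Y` meets `cl {p}` (so `X` contains a rank-`1` triple: `≤ (n − 3) · Q₃¹`), or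
`Y` is a dependent pair (`≤ D₂²`), or `{p} ∪ Y` is a triangle with `Y` outside `cl {p}` (a relative circuit of size `2` of
the set `{p} ∪ (E ∖ cl {p})`, of nullity `≤ 3`: `≤ 6` per pair) — or it has no dependent pair, and then it is a `4`-subset
of ONE line of `≤ 5` points (**`ncard_four_eRk_le_two_no_pair_le_five`**, `n ≥ 9`). **`ncard_four_eRk_le_two_le_split_of`**
is the split with a parameter `m` for the third class, **`ncard_four_eRk_le_two_le_split`** the split with `m = 6`
(**`ncard_four_eRk_le_two_through_pair_le_six`**, any `n`). Nothing about any cell is claimed. Axioms: standard.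
-/

open scoped Matroid

namespace PercRepro

namespace S1CFG

open Set S1CF

variable {α : Type}

/-- **The `4`-sets of rank `≤ 2` with no dependent pair lie in one line of `≤ 5` points: at most `5`** (`n ≥ 9`). -/
theorem ncard_four_eRk_le_two_no_pair_le_five (M : Matroid α) [M.Finite] (hL : ∀ e ∈ M.E, ¬ M.IsLoop e)
    (hK : ∀ e, ¬ M.IsColoop e) (hd : M.E.encard = M.eRank + ((4 : ℕ) : ℕ∞)) (hn : 9 ≤ M.E.ncard) :
    {X : Set α | X ⊆ M.E ∧ X.ncard = 4 ∧ M.eRk X ≤ 2 ∧ ∀ P ⊆ X, P.ncard = 2 → ¬ M.Dep P}.ncard ≤ 5 := by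
  classical
  have hEfin := M.ground_finite
  set 𝒬 := {X : Set α | X ⊆ M.E ∧ X.ncard = 4 ∧ M.eRk X ≤ 2 ∧ ∀ P ⊆ X, P.ncard = 2 → ¬ M.Dep P} with h𝒬
  rcases 𝒬.eq_empty_or_nonempty with hemp | ⟨X₀, hX₀⟩
  · rw [hemp]; simp
  obtain ⟨hX₀E, hX₀4, hX₀r, hX₀no⟩ := hX₀
  have hX₀fin : X₀.Finite := hEfin.subset hX₀E
  -- two distinct points of `X₀` form an independent pair spanning `X₀`
  obtain ⟨u, hu⟩ : X₀.Nonempty := by rw [← Set.ncard_pos hX₀fin, hX₀4]; norm_num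
  obtain ⟨v, hv, hvu⟩ := Set.exists_ne_of_one_lt_ncard (by rw [hX₀4]; norm_num) u
  have huv : ({u, v} : Set α) ⊆ X₀ := by intro w hw; rcases hw with rfl | rfl; exacts [hu, hv]
  have hind : M.Indep {u, v} := by
    rw [← Matroid.not_dep_iff (huv.trans hX₀E)]
    exact hX₀no _ huv (Set.ncard_pair (Ne.symm hvu))
  set L := M.closure {u, v} with hLdef
  have hLE : L ⊆ M.E := M.closure_subset_ground _
  have hLfin : L.Finite := hEfin.subset hLE
  have hLr : M.eRk L ≤ 2 := by
    rw [hLdef, M.eRk_closure_eq, hind.eRk_eq_encard, Set.encard_pair (Ne.symm hvu)]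
  have hL5 : L.ncard ≤ 5 := by
    have h2 := eRk_toNat_le_of_eRk_le M hLE (m := 2) (by exact_mod_cast hLr)
    have := ncard_le_eRk_toNat_add_three M hK hd hLE (by omega)
    omega
  -- `X₀ ⊆ L`, and every member of `𝒬` lies in `L`
  have hX₀L : X₀ ⊆ L := by
    intro w hw
    by_cases hwuv : w ∈ ({u, v} : Set α)
    · exact M.subset_closure _ (huv.trans hX₀E) hwuv
    · have hdep : M.Dep (insert w {u, v}) := by
        have hsub : insert w {u, v} ⊆ X₀ := Set.insert_subset hw huv
        have hfin : (insert w {u, v} : Set α).Finite := hX₀fin.subset hsub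
        rw [← Matroid.eRk_lt_encard_iff_dep_of_finite hfin (hsub.trans hX₀E),
          Set.encard_insert_of_notMem hwuv, Set.encard_pair (Ne.symm hvu)]
        calc M.eRk (insert w {u, v}) ≤ M.eRk X₀ := M.eRk_mono hsub
          _ ≤ 2 := hX₀r
          _ < 2 + 1 := by norm_num
      rw [hind.insert_dep_iff] at hdep
      exact hdep.1
  have hsub : 𝒬 ⊆ {X : Set α | X ⊆ L ∧ X.ncard = 4} := by
    intro X hX
    obtain ⟨hXE, hX4, hXr, hXno⟩ := hX
    refine ⟨?_, hX4⟩
    have hXfin : X.Finite := hEfin.subset hXE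
    -- the union `X₀ ∪ X` is a proper subset; its nullity forces `X` into `L`
    have hU : X₀ ∪ X ⊆ M.E := union_subset hX₀E hXE
    have hUr : M.eRk (X₀ ∪ X) + M.eRk (X₀ ∩ X) ≤ 4 := by
      have := M.eRk_inter_add_eRk_union_le X₀ X
      calc M.eRk (X₀ ∪ X) + M.eRk (X₀ ∩ X) = M.eRk (X₀ ∩ X) + M.eRk (X₀ ∪ X) := add_comm _ _
        _ ≤ M.eRk X₀ + M.eRk X := this
        _ ≤ 2 + 2 := add_le_add hX₀r hXr
        _ = 4 := by norm_num
    have hUcard := Set.ncard_union_add_ncard_inter X₀ X hX₀fin hXfin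
    -- case on the size of the intersection
    by_cases hI3 : 3 ≤ (X₀ ∩ X).ncard
    · -- three common points span `L`
      obtain ⟨a, ha⟩ : (X₀ ∩ X).Nonempty := by
        rw [← Set.ncard_pos (hX₀fin.subset inter_subset_left)]; omega
      obtain ⟨b, hb, hba⟩ := Set.exists_ne_of_one_lt_ncard (by omega : 1 < (X₀ ∩ X).ncard) a
      have hab : ({a, b} : Set α) ⊆ X₀ ∩ X := by intro w hw; rcases hw with rfl | rfl; exacts [ha, hb]
      have habind : M.Indep {a, b} := by
        rw [← Matroid.not_dep_iff ((hab.trans inter_subset_left).trans hX₀E)]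
        exact hX₀no _ (hab.trans inter_subset_left) (Set.ncard_pair (Ne.symm hba))
      -- `cl {a, b} = L` since `{a, b} ⊆ X₀ ⊆ L` spans rank 2
      have hcl : M.closure {a, b} = L := by
        apply le_antisymm
        · exact M.closure_subset_closure_of_subset_closure ((hab.trans inter_subset_left).trans hX₀L)
        · -- `L` has rank 2 and `{a, b}` is an independent pair inside it
          have h1 : M.closure {a, b} ⊆ L := M.closure_subset_closure_of_subset_closure
            ((hab.trans inter_subset_left).trans hX₀L)
          by_contra hne
          obtain ⟨z, hzL, hzcl⟩ := Set.not_subset.1 hne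
          have hzE : z ∈ M.E := hLE hzL
          have hind' : M.Indep (insert z {a, b}) := by
            rw [habind.insert_indep_iff_of_notMem (fun h => hzcl (M.subset_closure _
              ((hab.trans inter_subset_left).trans hX₀E) h))]
            exact ⟨hzE, hzcl⟩
          have h3 : M.eRk (insert z {a, b}) = 3 := by
            rw [hind'.eRk_eq_encard, Set.encard_insert_of_notMem (fun h => hzcl (M.subset_closure _
              ((hab.trans inter_subset_left).trans hX₀E) h)), Set.encard_pair (Ne.symm hba)]
            norm_num
          have hle : M.eRk (insert z {a, b}) ≤ M.eRk L :=
            M.eRk_mono (Set.insert_subset hzL ((hab.trans inter_subset_left).trans hX₀L))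
          rw [h3] at hle
          have : (3 : ℕ∞) ≤ 2 := hle.trans hLr
          norm_num at this
      -- `X ⊆ cl {a, b}`
      rw [← hcl]
      intro w hw
      by_cases hwab : w ∈ ({a, b} : Set α)
      · exact M.subset_closure _ ((hab.trans inter_subset_right).trans hXE) hwab
      · have hdep : M.Dep (insert w {a, b}) := by
          have hsub' : insert w {a, b} ⊆ X := Set.insert_subset hw (hab.trans inter_subset_right)
          have hfin : (insert w {a, b} : Set α).Finite := hXfin.subset hsub'
          rw [← Matroid.eRk_lt_encard_iff_dep_of_finite hfin (hsub'.trans hXE),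
            Set.encard_insert_of_notMem hwab, Set.encard_pair (Ne.symm hba)]
          calc M.eRk (insert w {a, b}) ≤ M.eRk X := M.eRk_mono hsub'
            _ ≤ 2 := hXr
            _ < 2 + 1 := by norm_num
        rw [habind.insert_dep_iff] at hdep
        exact hdep.1
    · -- at most two common points: `X₀ ∪ X` has `≥ 6` points and rank `≤ 4 − rk (X₀ ∩ X)`
      exfalso
      push Not at hI3
      have hUr' : (M.eRk (X₀ ∪ X)).toNat + (M.eRk (X₀ ∩ X)).toNat ≤ 4 := by
        have h := hUr
        rw [← S1.coe_toNat_eRk M hU, ← S1.coe_toNat_eRk M (inter_subset_left.trans hX₀E)] at h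
        exact_mod_cast h
      have hnull := ncard_le_eRk_toNat_add_three M hK hd hU (by omega)
      -- the intersection: empty, a point, or an independent pair
      rcases Nat.lt_or_ge (X₀ ∩ X).ncard 2 with hlt | hge
      · -- `|X₀ ∩ X| ≤ 1`: `|X₀ ∪ X| ≥ 7`, rank `≤ 3` (a common point has rank `1`)
        rcases Nat.lt_or_ge (X₀ ∩ X).ncard 1 with h0 | h1
        · omega
        · have hI1 : (X₀ ∩ X).ncard = 1 := by omega
          obtain ⟨a, ha⟩ := Set.ncard_eq_one.1 hI1
          have haI : a ∈ X₀ ∩ X := by rw [ha]; exact Set.mem_singleton a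
          have haE : a ∈ M.E := hX₀E haI.1
          have hr1 : (M.eRk (X₀ ∩ X)).toNat = 1 := by
            rw [ha, ((Matroid.not_isLoop_iff haE).1 (hL a haE)).eRk_eq]; rfl
          omega
      · -- `|X₀ ∩ X| = 2`: an independent pair, rank `2`, so `rk (X₀ ∪ X) ≤ 2` on `6` points
        have hI2 : (X₀ ∩ X).ncard = 2 := by omega
        obtain ⟨a, b, hab', hI⟩ := Set.ncard_eq_two.1 hI2
        have habind : M.Indep {a, b} := by
          have hsub' : ({a, b} : Set α) ⊆ X₀ := by rw [← hI]; exact inter_subset_left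
          rw [← Matroid.not_dep_iff (hsub'.trans hX₀E)]
          exact hX₀no _ hsub' (Set.ncard_pair hab')
        have h2 : (M.eRk (X₀ ∩ X)).toNat = 2 := by
          rw [hI, habind.eRk_eq_encard, Set.encard_pair hab']; rfl
        omega
  calc 𝒬.ncard ≤ {X : Set α | X ⊆ L ∧ X.ncard = 4}.ncard :=
        Set.ncard_le_ncard hsub (hLfin.finite_subsets.subset (fun X hX => hX.1))
    _ = L.ncard.choose 4 := ncard_subsets_eq_choose hLfin 4
    _ ≤ (5 : ℕ).choose 4 := Nat.choose_le_choose 4 hL5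
    _ = 5 := by decide

/-- The nullity of `{p} ∪ (E ∖ cl {p})` is at most `3` when `p` has a parallel partner (any `n`). -/
theorem ncard_insert_sdiff_closure_le (M : Matroid α) [M.Finite] (hd : M.E.encard = M.eRank + ((4 : ℕ) : ℕ∞))
    {p : α} (hp : p ∈ M.E) (h2 : 2 ≤ (M.closure {p}).ncard) :
    (insert p (M.E \ M.closure {p})).ncard ≤ (M.eRk (insert p (M.E \ M.closure {p}))).toNat + 3 := by
  have hEfin := M.ground_finite
  set Z := insert p (M.E \ M.closure {p}) with hZdef
  have hZE : Z ⊆ M.E := Set.insert_subset hp sdiff_subset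
  have hcl : M.closure {p} ⊆ M.E := M.closure_subset_ground _
  -- rank of `Z` is the rank of `E`
  have hrk : M.eRk Z = M.eRk M.E := by
    apply le_antisymm (M.eRk_mono hZE)
    have hsub : M.E ⊆ M.closure Z := by
      intro w hw
      by_cases hwp : w ∈ M.closure {p}
      · exact M.closure_subset_closure (Set.singleton_subset_iff.2 (Set.mem_insert p _)) hwp
      · exact M.subset_closure Z hZE (Or.inr ⟨hw, hwp⟩)
    calc M.eRk M.E ≤ M.eRk (M.closure Z) := M.eRk_mono hsub
      _ = M.eRk Z := M.eRk_closure_eq Z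
  have hpcl : p ∈ M.closure {p} := M.mem_closure_self p hp
  have hZcard : Z.ncard + (M.closure {p}).ncard = M.E.ncard + 1 := by
    have h1 : Z.ncard = (M.E \ M.closure {p}).ncard + 1 :=
      Set.ncard_insert_of_notMem (fun h => h.2 hpcl) (hEfin.subset sdiff_subset)
    have h2 := Set.ncard_sdiff_add_ncard_of_subset hcl hEfin
    omega
  have h8 := eRk_ground_toNat_eq M hd
  have hn4 := ncard_ground_eq_eRk_toNat_add M hd
  rw [hrk]
  omega

/-- The members of the third class of `4`-sets through a dependent pair `P` number at most `6` (any `n`): they are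
`P ∪ Y` with `Y` a relative circuit of size `2` of `{p} ∪ (E ∖ cl {p})`. -/
theorem ncard_four_eRk_le_two_through_pair_le_six (M : Matroid α) [M.Finite] (hL : ∀ e ∈ M.E, ¬ M.IsLoop e)
    (hd : M.E.encard = M.eRank + ((4 : ℕ) : ℕ∞)) {P : Set α} (hPE : P ⊆ M.E)
    (hP2 : P.ncard = 2) (hPdep : M.Dep P) :
    {X : Set α | X ⊆ M.E ∧ X.ncard = 4 ∧ P ⊆ X ∧ M.eRk X ≤ 2 ∧
      (∀ Z ⊆ X, Z.ncard = 3 → ¬ M.eRk Z ≤ 1) ∧ ¬ M.Dep (X \ P)}.ncard ≤ 6 := by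
  classical
  have hEfin := M.ground_finite
  obtain ⟨p, p', hpp', rfl⟩ := Set.ncard_eq_two.1 hP2
  have hpE : p ∈ M.E := hPE (by simp)
  have hp'E : p' ∈ M.E := hPE (by simp)
  have hLp := hL p hpE
  have hp'cl : p' ∈ M.closure {p} := mem_closure_singleton_of_dep_pair M hpE hLp hPdep
  have hpcl : p ∈ M.closure {p} := M.mem_closure_self p hpE
  have hF2 : 2 ≤ (M.closure {p}).ncard := by
    have : ({p, p'} : Set α) ⊆ M.closure {p} := by
      intro w hw; rcases hw with rfl | rfl; exacts [hpcl, hp'cl]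
    rw [← Set.ncard_pair hpp']
    exact Set.ncard_le_ncard this (hEfin.subset (M.closure_subset_ground _))
  set Y := M.E \ M.closure {p} with hYdef
  have hYE : Y ⊆ M.E := sdiff_subset
  have hpY : Disjoint {p} Y := Set.disjoint_singleton_left.2 (fun h => h.2 hpcl)
  have hpind : M.Indep {p} := indep_singleton_of_not_isLoop M hpE hLp
  have hν := ncard_insert_sdiff_closure_le M hd hpE hF2
  rw [← Set.singleton_union] at hν
  have hrel := ncard_relCircuits_le M 2 (by norm_num) 3 {p} Y (Set.singleton_subset_iff.2 hpE) hYE hpY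
    hpind hν
  norm_num at hrel
  -- the injection `X ↦ X ∖ P`
  have hmap : ∀ X ∈ {X : Set α | X ⊆ M.E ∧ X.ncard = 4 ∧ {p, p'} ⊆ X ∧ M.eRk X ≤ 2 ∧
      (∀ Z ⊆ X, Z.ncard = 3 → ¬ M.eRk Z ≤ 1) ∧ ¬ M.Dep (X \ {p, p'})},
      (fun X : Set α => X \ {p, p'}) X ∈
        {Q : Set α | Q ⊆ Y ∧ Q.ncard = 2 ∧ M.Dep ({p} ∪ Q) ∧ ∀ R, R ⊂ Q → M.Indep ({p} ∪ R)} := by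
    intro X hX
    obtain ⟨hXE, hX4, hPX, hXr, hno1, hXP⟩ := hX
    have hXfin : X.Finite := hEfin.subset hXE
    have hQ2 : (X \ {p, p'}).ncard = 2 := by
      have := Set.ncard_sdiff_add_ncard_of_subset hPX hXfin
      rw [Set.ncard_pair hpp'] at this
      omega
    have hQY : X \ {p, p'} ⊆ Y := by
      intro w hw
      refine ⟨hXE hw.1, fun hwcl => ?_⟩
      -- `{p, p'} ∪ {w}` would be a rank-1 triple inside `X`
      apply hno1 (insert w {p, p'}) (Set.insert_subset hw.1 hPX)
      · rw [Set.ncard_insert_of_notMem hw.2, Set.ncard_pair hpp']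
      · exact eRk_le_one_of_subset_closure_singleton M (x := p) (by
          intro z hz
          simp only [Set.mem_insert_iff, Set.mem_singleton_iff] at hz
          rcases hz with rfl | rfl | rfl
          · exact hwcl
          · exact hpcl
          · exact hp'cl)
    refine ⟨hQY, hQ2, ?_, ?_⟩
    · -- `{p} ∪ (X ∖ P)` has 3 points and rank ≤ 2
      have hsub : {p} ∪ (X \ {p, p'}) ⊆ X := union_subset (Set.singleton_subset_iff.2 (hPX (by simp)))
        sdiff_subset
      have hfin : ({p} ∪ (X \ {p, p'}) : Set α).Finite := hXfin.subset hsub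
      have hc : ({p} ∪ (X \ {p, p'}) : Set α).ncard = 3 := by
        rw [Set.ncard_union_eq (Set.disjoint_singleton_left.2 (fun h => h.2 (by simp)))
          (Set.finite_singleton p) (hXfin.subset sdiff_subset), Set.ncard_singleton, hQ2]
      rw [← Matroid.eRk_lt_encard_iff_dep_of_finite hfin (hsub.trans hXE), ← hfin.cast_ncard_eq, hc]
      exact lt_of_le_of_lt (M.eRk_mono hsub) (lt_of_le_of_lt hXr (by norm_num))
    · -- proper subsets of `X ∖ P`: empty or a singleton outside `cl {p}`
      intro R hR
      have hR1 : R.ncard ≤ 1 := by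
        have : R.ncard < (X \ {p, p'}).ncard := Set.ncard_lt_ncard hR (hXfin.subset sdiff_subset)
        omega
      rw [Set.ncard_le_one_iff_eq ((hXfin.subset sdiff_subset).subset hR.subset)] at hR1
      rcases hR1 with rfl | ⟨w, rfl⟩
      · simpa using hpind
      · have hwY : w ∈ Y := hQY (hR.subset (Set.mem_singleton w))
        rw [Set.union_singleton, hpind.insert_indep_iff_of_notMem (fun h => hwY.2 (by
          rw [Set.mem_singleton_iff] at h; rw [h]; exact hpcl))]
        exact ⟨hwY.1, hwY.2⟩
  have hinj : Set.InjOn (fun X : Set α => X \ {p, p'})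
      {X : Set α | X ⊆ M.E ∧ X.ncard = 4 ∧ {p, p'} ⊆ X ∧ M.eRk X ≤ 2 ∧
        (∀ Z ⊆ X, Z.ncard = 3 → ¬ M.eRk Z ≤ 1) ∧ ¬ M.Dep (X \ {p, p'})} := by
    intro X hX X' hX' h
    simp only at h
    rw [← Set.union_sdiff_cancel hX.2.2.1, ← Set.union_sdiff_cancel hX'.2.2.1, h]
  exact (Set.ncard_le_ncard_of_injOn _ hmap hinj (relCircuits_finite M {p} hYE 2)).trans hrel

/-- **The split** `Q₄² ≤ 5 + (n − 3) · Q₃¹ + D₂ · D₂ + m · D₂` (`n ≥ 9`), for any `m` bounding, for every dependent pair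
`P`, the `4`-sets `X ⊇ P` of rank `≤ 2` with no rank-`1` triple and `X ∖ P` independent. -/
theorem ncard_four_eRk_le_two_le_split_of (M : Matroid α) [M.Finite] (hL : ∀ e ∈ M.E, ¬ M.IsLoop e)
    (hK : ∀ e, ¬ M.IsColoop e) (hd : M.E.encard = M.eRank + ((4 : ℕ) : ℕ∞)) (hn : 9 ≤ M.E.ncard) (m : ℕ)
    (hm : ∀ P, P ⊆ M.E → P.ncard = 2 → M.Dep P →
      {X : Set α | X ⊆ M.E ∧ X.ncard = 4 ∧ P ⊆ X ∧ M.eRk X ≤ 2 ∧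
        (∀ Z ⊆ X, Z.ncard = 3 → ¬ M.eRk Z ≤ 1) ∧ ¬ M.Dep (X \ P)}.ncard ≤ m) :
    {X : Set α | X ⊆ M.E ∧ X.ncard = 4 ∧ M.eRk X ≤ 2}.ncard ≤
      5 + (M.E.ncard - 3) * {Z : Set α | Z ⊆ M.E ∧ Z.ncard = 3 ∧ M.eRk Z ≤ 1}.ncard +
        {P : Set α | P ⊆ M.E ∧ P.ncard = 2 ∧ M.Dep P}.ncard * {P : Set α | P ⊆ M.E ∧ P.ncard = 2 ∧ M.Dep P}.ncard +
          m * {P : Set α | P ⊆ M.E ∧ P.ncard = 2 ∧ M.Dep P}.ncard := by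
  classical
  have hEfin := M.ground_finite
  set 𝒟 := {P : Set α | P ⊆ M.E ∧ P.ncard = 2 ∧ M.Dep P} with h𝒟
  have h𝒟fin : 𝒟.Finite := hEfin.finite_subsets.subset (fun P hP => hP.1)
  set Q0 := {X : Set α | X ⊆ M.E ∧ X.ncard = 4 ∧ M.eRk X ≤ 2 ∧ ∀ P ⊆ X, P.ncard = 2 → ¬ M.Dep P} with hQ0
  set Qa := {X : Set α | X ⊆ M.E ∧ X.ncard = 4 ∧
    ∃ T ∈ {Z : Set α | Z ⊆ M.E ∧ Z.ncard = 3 ∧ M.eRk Z ≤ 1}, T ⊆ X} with hQa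
  set Qb := (fun PP : Set α × Set α => PP.1 ∪ PP.2) '' (𝒟 ×ˢ 𝒟) with hQb
  set T : Set α → Set (Set α) := fun P => {X : Set α | X ⊆ M.E ∧ X.ncard = 4 ∧ P ⊆ X ∧ M.eRk X ≤ 2 ∧
    (∀ Z ⊆ X, Z.ncard = 3 → ¬ M.eRk Z ≤ 1) ∧ ¬ M.Dep (X \ P)} with hT
  set Qc := {X : Set α | ∃ P ∈ 𝒟, X ∈ T P} with hQc
  have hsplit : {X : Set α | X ⊆ M.E ∧ X.ncard = 4 ∧ M.eRk X ≤ 2} ⊆ Q0 ∪ Qa ∪ Qb ∪ Qc := by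
    intro X hX
    obtain ⟨hXE, hX4, hXr⟩ := hX
    have hXfin : X.Finite := hEfin.subset hXE
    by_cases hpair : ∃ P ⊆ X, P.ncard = 2 ∧ M.Dep P
    · obtain ⟨P, hPX, hP2, hPdep⟩ := hpair
      by_cases htriple : ∃ Z ⊆ X, Z.ncard = 3 ∧ M.eRk Z ≤ 1
      · obtain ⟨Z, hZX, hZ3, hZr⟩ := htriple
        exact Or.inl (Or.inl (Or.inr ⟨hXE, hX4, Z, ⟨hZX.trans hXE, hZ3, hZr⟩, hZX⟩))
      by_cases hrest : M.Dep (X \ P)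
      · refine Or.inl (Or.inr ⟨(P, X \ P), ⟨⟨hPX.trans hXE, hP2, hPdep⟩, ⟨sdiff_subset.trans hXE, ?_, hrest⟩⟩, ?_⟩)
        · show (X \ P).ncard = 2
          have := Set.ncard_sdiff_add_ncard_of_subset hPX hXfin
          omega
        · simp only
          exact Set.union_sdiff_cancel hPX
      · refine Or.inr ⟨P, ⟨hPX.trans hXE, hP2, hPdep⟩, hXE, hX4, hPX, hXr, ?_, hrest⟩
        intro Z hZX hZ3 hZr
        exact htriple ⟨Z, hZX, hZ3, hZr⟩
    · push Not at hpair
      exact Or.inl (Or.inl (Or.inl ⟨hXE, hX4, hXr, hpair⟩))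
  have h0 : Q0.ncard ≤ 5 := ncard_four_eRk_le_two_no_pair_le_five M hL hK hd hn
  have ha : Qa.ncard ≤ (M.E.ncard - 3) * {Z : Set α | Z ⊆ M.E ∧ Z.ncard = 3 ∧ M.eRk Z ≤ 1}.ncard := by
    have := ncard_with_member_le hEfin {Z : Set α | Z ⊆ M.E ∧ Z.ncard = 3 ∧ M.eRk Z ≤ 1} 3 4
      (fun Z hZ => ⟨hZ.1, hZ.2.1⟩)
    rw [show (4 : ℕ) - 3 = 1 by norm_num, Nat.choose_one_right] at this
    exact this
  have hb : Qb.ncard ≤ 𝒟.ncard * 𝒟.ncard := by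
    calc Qb.ncard ≤ (𝒟 ×ˢ 𝒟).ncard := Set.ncard_image_le (h𝒟fin.prod h𝒟fin)
      _ = 𝒟.ncard * 𝒟.ncard := Set.ncard_prod
  have hc : Qc.ncard ≤ m * 𝒟.ncard := by
    apply ncard_exists_mem_le h𝒟fin T
    intro P hP
    exact ⟨hEfin.finite_subsets.subset (fun X hX => hX.1), hm P hP.1 hP.2.1 hP.2.2⟩
  have hQ0fin : Q0.Finite := hEfin.finite_subsets.subset (fun X hX => hX.1)
  have hQafin : Qa.Finite := hEfin.finite_subsets.subset (fun X hX => hX.1)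
  have hQbfin : Qb.Finite := (h𝒟fin.prod h𝒟fin).image _
  have hQcfin : Qc.Finite := hEfin.finite_subsets.subset (fun X hX => by
    obtain ⟨P, -, hXP⟩ := hX
    exact hXP.1)
  calc {X : Set α | X ⊆ M.E ∧ X.ncard = 4 ∧ M.eRk X ≤ 2}.ncard
      ≤ (Q0 ∪ Qa ∪ Qb ∪ Qc).ncard :=
        Set.ncard_le_ncard hsplit (((hQ0fin.union hQafin).union hQbfin).union hQcfin)
    _ ≤ (Q0 ∪ Qa ∪ Qb).ncard + Qc.ncard := Set.ncard_union_le _ _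
    _ ≤ (Q0 ∪ Qa).ncard + Qb.ncard + Qc.ncard := by gcongr; exact Set.ncard_union_le _ _
    _ ≤ Q0.ncard + Qa.ncard + Qb.ncard + Qc.ncard := by gcongr; exact Set.ncard_union_le _ _
    _ ≤ 5 + (M.E.ncard - 3) * {Z : Set α | Z ⊆ M.E ∧ Z.ncard = 3 ∧ M.eRk Z ≤ 1}.ncard + 𝒟.ncard * 𝒟.ncard +
          m * 𝒟.ncard := by gcongr

/-- **`Q₄² ≤ 5 + (n − 3) · Q₃¹ + D₂ · D₂ + 6 · D₂`** (`n ≥ 9`; the split with the relative circuit count). -/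
theorem ncard_four_eRk_le_two_le_split (M : Matroid α) [M.Finite] (hL : ∀ e ∈ M.E, ¬ M.IsLoop e)
    (hK : ∀ e, ¬ M.IsColoop e) (hd : M.E.encard = M.eRank + ((4 : ℕ) : ℕ∞)) (hn : 9 ≤ M.E.ncard) :
    {X : Set α | X ⊆ M.E ∧ X.ncard = 4 ∧ M.eRk X ≤ 2}.ncard ≤
      5 + (M.E.ncard - 3) * {Z : Set α | Z ⊆ M.E ∧ Z.ncard = 3 ∧ M.eRk Z ≤ 1}.ncard +
        {P : Set α | P ⊆ M.E ∧ P.ncard = 2 ∧ M.Dep P}.ncard * {P : Set α | P ⊆ M.E ∧ P.ncard = 2 ∧ M.Dep P}.ncard +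
          6 * {P : Set α | P ⊆ M.E ∧ P.ncard = 2 ∧ M.Dep P}.ncard :=
  ncard_four_eRk_le_two_le_split_of M hL hK hd hn 6
    (fun _ hPE hP2 hPdep => ncard_four_eRk_le_two_through_pair_le_six M hL hd hPE hP2 hPdep)

end S1CFG

end PercRepro
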